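import Literature.MathematicalPhysics.QuantumLattice.HubbardMatsubaraShellSums
import Literature.MathematicalPhysics.QuantumLattice.HubbardUVSymbolCTDifferences
import Literature.MathematicalPhysics.QuantumLattice.HubbardGridPropagatorGram
import Literature.MathematicalPhysics.QuantumLattice.HubbardGridTwoPointBound
import HarnessLib

/-!
# The Matsubara shell covariance at zero seed: normal form, Fourier–Gram constant and entry bound on any position–time grid

Topic `MathematicalPhysics/QuantumLattice`; continuation of `HubbardMatsubaraCutoffBlocks` (the shell covariance
`S = hubbardCovShellCT L h β μ h_s K Λ = C″^K_{>Λ} − Eᵀ C^K_{>Λ} E` of two cutoffs `M ≤ M″`) and `HubbardMatsubaraShellSums` (the shell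
finset and its `O(1/M)` sums), in the currency of the determinant-bounded single-scale step
(`GrassmannEffectiveActionTruncationDB.sum_norm_kernel_effAction_sub_gaussConv_le_of_gramBounded`: a Gram constant `κ` of the
pulled-back covariance `S(x,τ)ᵀ·C·S(x,τ)` of the position–time fields, `HubbardGridFieldSubstitution.gridSubMatrix`):

* §1 `shellSymbolCT L h β μ K Λ` — the symbol `[n ∈ shell]·w^K_Λ·βL²(iω+e_K)/(ω²+e_K²)` on `FreqMomentum L M″ × Fin 2`, and the NORMAL FORM
  **`hubbardCovShellCT_zero_seed`**: `S = normalCovariance L M″ (shellSymbolCT …)` at seed `h_s = 0` (so every grid/sector tool of the tree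
  for normal covariances applies to the shell);
* §2 sizes of the symbol: `‖uvSymbolCT … k‖ ≤ βL²/|ω_k|` (any `Λ`, weight `≤ 1`), `‖shellSymbolCT … k‖ ≤ βL²·β/(π(2M+1))`, and the
  phase-space sum **`Σ_k ‖shellSymbolCT … (k,σ)‖ ≤ βL²·L²·2(M″−M)β/(π(2M+1))`** (`sum_shell_one_div_abs_le`);
* §3 the Fourier–Gram form on ANY grid `(x, τ) : P → (ℤ/L)² × ℝ`: `‖F_X‖², ‖G_Y‖² ≤ κ_S² := 2(M″−M)/(π(2M+1))`
  (`norm_sq_gridGramF/G_shell_le`), hence **`isGramBoundedR_gridSub_hubbardCovShellCT`**: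
  `IsGramBoundedR (S(x,τ)ᵀ·S·S(x,τ)) √κ_S²` — `< 1/√π·…`, BOUNDED for a dyadic shell `M″ ≤ 2M` (compare cutoffs dyadically) — the
  charge hypothesis `gridSub_hubbardCovShellCT_apply_of_charge_eq`, and the ENTRY bound
  **`norm_gridSub_hubbardCovShellCT_le`**: `‖(S(x,τ)ᵀ·S·S(x,τ)) X Y‖ ≤ κ_S²` (what the tadpole `e^{Δ_S}V − V` of the shell integration reads).

Everything is proved; `shellSymbolCT` is the only definition; no named fact.

## Sources

W. de S. Pedra, M. Salmhofer, Commun. Math. Phys. 282 (2008) 797–818, §5 Lemma 5.1 (the Fourier Gram constant of the ultraviolet part of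
the frequency split) [`PedraSalmhofer2008`]; G. Benfatto, A. Giuliani, V. Mastropietro, Ann. Henri Poincaré 7 (2006) 809–898, §2.8 (2.80)
(Gram form of a propagator: phase-space sum of the symbol) [`BenfattoGiulianiMastropietro2006`].  The `[cite: …]` tags LOCATE the
construct each statement is about; the statements are elementary bookkeeping / estimates, not named results of those sources.
-/

noncomputable section

namespace Literature.MathematicalPhysics.QuantumLattice

open Finset Complex Literature.Probability.LatticeModels GrassmannAlgebra
open scoped InnerProductSpace

variable {L : ℕ} [NeZero L] {M M'' : ℕ}

/-! ### §1 The shell symbol and the normal form of the shell covariance at zero seed -/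

variable (L) in
/-- **The shell symbol** between the cutoffs `M ≤ M″`: the ultraviolet symbol `w^K_Λ(k)·βL²·(iω+e_K)/(ω²+e_K²)` of `C″^K_{>Λ}`
(`uvSymbolCT L M″ β μ K Λ`) restricted to the SHELL frequencies, `0` on the window. [cite: PedraSalmhofer2008, §5 Lemma 5.1] -/
def shellSymbolCT (h : M ≤ M'') (β μ : ℝ) (K : TrigPolyC4v) (Λ : ℝ) (ks : FreqMomentum L M'' × Fin 2) : ℂ :=
  if ks.1.1 ∈ MatsubaraIdx.shell h then uvSymbolCT L M'' β μ K Λ ks else 0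

/-- The shell symbol on the shell. [cite: PedraSalmhofer2008, §5 Lemma 5.1] -/
theorem shellSymbolCT_of_mem (h : M ≤ M'') (β μ : ℝ) (K : TrigPolyC4v) (Λ : ℝ) {ks : FreqMomentum L M'' × Fin 2}
    (hk : ks.1.1 ∈ MatsubaraIdx.shell h) : shellSymbolCT L h β μ K Λ ks = uvSymbolCT L M'' β μ K Λ ks := by
  rw [shellSymbolCT, if_pos hk]

/-- The shell symbol vanishes on the window. [cite: PedraSalmhofer2008, §5 Lemma 5.1] -/
theorem shellSymbolCT_of_not_mem (h : M ≤ M'') (β μ : ℝ) (K : TrigPolyC4v) (Λ : ℝ) {ks : FreqMomentum L M'' × Fin 2}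
    (hk : ks.1.1 ∉ MatsubaraIdx.shell h) : shellSymbolCT L h β μ K Λ ks = 0 := by
  rw [shellSymbolCT, if_neg hk]

/-- The shell symbol vanishes at embedded labels. [cite: PedraSalmhofer2008, §5 Lemma 5.1] -/
theorem shellSymbolCT_emb (h : M ≤ M'') (β μ : ℝ) (K : TrigPolyC4v) (Λ : ℝ) (k : FreqMomentum L M) (σ : Fin 2) :
    shellSymbolCT L h β μ K Λ (FreqMomentum.emb h k, σ) = 0 :=
  shellSymbolCT_of_not_mem h β μ K Λ (by rw [MatsubaraIdx.mem_shell_iff, FreqMomentum.emb_fst]; exact fun hn => hn ⟨k.1, rfl⟩)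

omit [NeZero L] in
/-- A field label is off the window iff its frequency label is on the shell. [cite: PedraSalmhofer2008, §5 Lemma 5.1] -/
theorem not_mem_range_emb_iff_mem_shell (h : M ≤ M'') (X : HubbardFieldIdx L M'') :
    X ∉ Set.range (HubbardFieldIdx.emb (L := L) h) ↔ (momentumOf L M'' X).1 ∈ MatsubaraIdx.shell h := by
  rw [HubbardFieldIdx.mem_range_emb_iff, FreqMomentum.mem_range_emb_iff, MatsubaraIdx.mem_shell_iff]

/-- **The shell covariance at zero seed is the normal covariance of the shell symbol.** [cite: PedraSalmhofer2008, §5 Lemma 5.1] -/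
theorem hubbardCovShellCT_zero_seed (h : M ≤ M'') (β μ : ℝ) (K : TrigPolyC4v) (Λ : ℝ) :
    hubbardCovShellCT L h β μ 0 K Λ = normalCovariance L M'' (shellSymbolCT L h β μ K Λ) := by
  ext X Y
  by_cases hX : X ∈ Set.range (HubbardFieldIdx.emb (L := L) h)
  · -- window row: both sides vanish
    have hXs : (momentumOf L M'' X).1 ∉ MatsubaraIdx.shell h := fun hs =>
      ((not_mem_range_emb_iff_mem_shell h X).2 hs) hX
    obtain ⟨X₀, rfl⟩ := hX
    rw [hubbardCovShellCT_emb_left, normalCovariance_apply]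
    have h0 : shellSymbolCT L h β μ K Λ (HubbardFieldIdx.emb h X₀).1 = 0 := shellSymbolCT_of_not_mem h β μ K Λ hXs
    rw [h0, neg_zero]
    split_ifs <;> rfl
  by_cases hY : Y ∈ Set.range (HubbardFieldIdx.emb (L := L) h)
  · -- shell row, window column: both sides vanish (`X.1 ≠ Y.1`)
    obtain ⟨Y₀, rfl⟩ := hY
    rw [hubbardCovShellCT_emb_right, normalCovariance_apply, if_neg]
    intro hXY
    apply hX
    rw [HubbardFieldIdx.mem_range_emb_iff]
    refine ⟨momentumOf L M Y₀, ?_⟩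
    change FreqMomentum.emb h Y₀.1.1 = X.1.1
    rw [hXY]
    rfl
  · -- shell × shell: the entry of `C″^K_{>Λ}`, a normal covariance with the full ultraviolet symbol
    rw [hubbardCovShellCT_of_not_mem h β μ 0 K Λ hX hY, hubbardCovAboveCT_zero_seed_eq_normalCovariance_uvSymbolCT,
      normalCovariance_apply, normalCovariance_apply,
      shellSymbolCT_of_mem h β μ K Λ ((not_mem_range_emb_iff_mem_shell h X).1 hX)]

/-! ### §2 Sizes of the symbol -/

/-- **The ultraviolet symbol is at most `βL²/|ω|`** (any frame, any scale: the weight is in `[0,1]` and `|iω+e|/(ω²+e²) ≤ 1/|ω|`).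
[cite: BenfattoGiulianiMastropietro2006, §2.8 (2.80)] -/
theorem norm_uvSymbolCT_le {N : ℕ} {β : ℝ} (hβ : 0 < β) (μ : ℝ) (K : TrigPolyC4v) (Λ : ℝ) (ks : FreqMomentum L N × Fin 2) :
    ‖uvSymbolCT L N β μ K Λ ks‖ ≤ β * (L : ℝ) ^ 2 * (1 / |matsubaraFreq β N ks.1.1|) := by
  have hw := salmhoferCutoff_mem_Icc ((matsubaraFreq β N ks.1.1 ^ 2 + nambuXiCT L μ K ks.1.2 ^ 2) / Λ ^ 2)
  have hG : ‖(Complex.I * matsubaraFreq β N ks.1.1 + nambuXiCT L μ K ks.1.2) / nambuDenCT L N β μ 0 K ks.1‖ ≤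
      1 / |matsubaraFreq β N ks.1.1| := by
    have h := norm_nambuPropagatorCT_le (L := L) hβ.ne' μ 0 K ks.1 0 0
    simpa [nambuPropagatorCT] using h
  rw [uvSymbolCT, norm_mul, norm_mul, Complex.norm_real, Complex.norm_real, hubbardCutoffWeightCT, Real.norm_of_nonneg hw.1,
    Real.norm_of_nonneg (show (0 : ℝ) ≤ β * (L : ℝ) ^ 2 by positivity)]
  calc _ ≤ 1 * (β * (L : ℝ) ^ 2 * (1 / |matsubaraFreq β N ks.1.1|)) :=
        mul_le_mul hw.2 (mul_le_mul_of_nonneg_left hG (by positivity)) (by positivity) zero_le_one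
    _ = _ := one_mul _

/-- **The shell symbol is at most `[shell]·βL²/|ω|`.** [cite: PedraSalmhofer2008, §5 Lemma 5.2] -/
theorem norm_shellSymbolCT_le {β : ℝ} (hβ : 0 < β) (h : M ≤ M'') (μ : ℝ) (K : TrigPolyC4v) (Λ : ℝ) (ks : FreqMomentum L M'' × Fin 2) :
    ‖shellSymbolCT L h β μ K Λ ks‖ ≤
      if ks.1.1 ∈ MatsubaraIdx.shell h then β * (L : ℝ) ^ 2 * (1 / |matsubaraFreq β M'' ks.1.1|) else 0 := by
  rw [shellSymbolCT]
  split_ifs with hk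
  · exact norm_uvSymbolCT_le hβ μ K Λ ks
  · rw [norm_zero]

/-- **The shell symbol is at most `βL²·β/(π(2M+1))`** (the shell floor). [cite: PedraSalmhofer2008, §5 Lemma 5.2] -/
theorem norm_shellSymbolCT_le_floor {β : ℝ} (hβ : 0 < β) (h : M ≤ M'') (μ : ℝ) (K : TrigPolyC4v) (Λ : ℝ) (ks : FreqMomentum L M'' × Fin 2) :
    ‖shellSymbolCT L h β μ K Λ ks‖ ≤ β * (L : ℝ) ^ 2 * (β / (Real.pi * (2 * M + 1))) := by
  refine (norm_shellSymbolCT_le hβ h μ K Λ ks).trans ?_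
  split_ifs with hk
  · exact mul_le_mul_of_nonneg_left (one_div_abs_matsubaraFreq_le_of_mem_shell hβ h hk) (by positivity)
  · positivity

/-- **The phase-space sum of the shell symbol**: `Σ_k ‖shellSymbolCT … (k,σ)‖ ≤ βL²·L²·2(M″−M)β/(π(2M+1))` (momenta × the Fourier–Gram
sum of the shell frequencies). [cite: PedraSalmhofer2008, §5 Lemma 5.1] -/
theorem sum_norm_shellSymbolCT_le {β : ℝ} (hβ : 0 < β) (h : M ≤ M'') (μ : ℝ) (K : TrigPolyC4v) (Λ : ℝ) (σ : Fin 2) :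
    ∑ k : FreqMomentum L M'', ‖shellSymbolCT L h β μ K Λ (k, σ)‖ ≤
      β * (L : ℝ) ^ 2 * ((L : ℝ) ^ 2 * (2 * ((M'' : ℝ) - M) * (β / (Real.pi * (2 * M + 1))))) := by
  calc ∑ k : FreqMomentum L M'', ‖shellSymbolCT L h β μ K Λ (k, σ)‖
      ≤ ∑ k : FreqMomentum L M'', (if k.1 ∈ MatsubaraIdx.shell h then β * (L : ℝ) ^ 2 * (1 / |matsubaraFreq β M'' k.1|) else 0) :=
        sum_le_sum fun k _ => norm_shellSymbolCT_le hβ h μ K Λ (k, σ)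
    _ = ∑ kv : TorusSite 2 L, ∑ i ∈ MatsubaraIdx.shell h, β * (L : ℝ) ^ 2 * (1 / |matsubaraFreq β M'' i|) := by
        rw [Fintype.sum_prod_type, sum_comm]
        refine sum_congr rfl fun kv _ => ?_
        dsimp only
        rw [Finset.sum_ite_mem, Finset.univ_inter]
    _ = (L : ℝ) ^ 2 * (β * (L : ℝ) ^ 2 * ∑ i ∈ MatsubaraIdx.shell h, 1 / |matsubaraFreq β M'' i|) := by
        rw [sum_const, ← mul_sum, nsmul_eq_mul]
        simp only [Finset.card_univ, Fintype.card_pi, ZMod.card, prod_const, Fintype.card_fin]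
        push_cast
        ring
    _ ≤ (L : ℝ) ^ 2 * (β * (L : ℝ) ^ 2 * (2 * ((M'' : ℝ) - M) * (β / (Real.pi * (2 * M + 1))))) := by
        gcongr
        exact sum_shell_one_div_abs_le hβ h
    _ = _ := by ring

/-! ### §3 The Fourier–Gram form of the shell covariance on a position–time grid -/

section Gram

variable {P : Type*}

/-- **The left Gram vector of the shell**: `‖F_X‖² ≤ κ_S² = 2(M″−M)/(π(2M+1))`. [cite: BenfattoGiulianiMastropietro2006, §2.8 (2.80)] -/
theorem norm_sq_gridGramF_shell_le {β : ℝ} (hβ : 0 < β) (h : M ≤ M'') (μ : ℝ) (K : TrigPolyC4v) (Λ : ℝ)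
    (x : P → TorusSite 2 L) (τ : P → ℝ) (X : GridLeg P) :
    ‖gridGramF L M'' β x τ (shellSymbolCT L h β μ K Λ) X‖ ^ 2 ≤ 2 * ((M'' : ℝ) - M) / (Real.pi * (2 * M + 1)) := by
  have hL : (0 : ℝ) < L := by exact_mod_cast Nat.pos_of_ne_zero (NeZero.ne L)
  rw [norm_sq_gridGramF, ← mul_sum]
  have hc : ‖((1 / (β * (L : ℝ) ^ 2) : ℝ) : ℂ)‖ ^ 2 = (1 / (β * (L : ℝ) ^ 2)) ^ 2 := by
    rw [Complex.norm_real, Real.norm_of_nonneg (by positivity)]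
  rw [hc]
  calc (1 / (β * (L : ℝ) ^ 2)) ^ 2 * ∑ k : FreqMomentum L M'', ‖shellSymbolCT L h β μ K Λ (k, X.1.2)‖
      ≤ (1 / (β * (L : ℝ) ^ 2)) ^ 2 * (β * (L : ℝ) ^ 2 * ((L : ℝ) ^ 2 * (2 * ((M'' : ℝ) - M) * (β / (Real.pi * (2 * M + 1)))))) :=
        mul_le_mul_of_nonneg_left (sum_norm_shellSymbolCT_le hβ h μ K Λ _) (by positivity)
    _ = 2 * ((M'' : ℝ) - M) / (Real.pi * (2 * M + 1)) := by
        field_simp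

/-- **The right Gram vector of the shell**: `‖G_Y‖² ≤ κ_S²`. [cite: BenfattoGiulianiMastropietro2006, §2.8 (2.80)] -/
theorem norm_sq_gridGramG_shell_le {β : ℝ} (hβ : 0 < β) (h : M ≤ M'') (μ : ℝ) (K : TrigPolyC4v) (Λ : ℝ)
    (x : P → TorusSite 2 L) (τ : P → ℝ) (Y : GridLeg P) :
    ‖gridGramG L M'' β x τ (shellSymbolCT L h β μ K Λ) Y‖ ^ 2 ≤ 2 * ((M'' : ℝ) - M) / (Real.pi * (2 * M + 1)) := by
  have hL : (0 : ℝ) < L := by exact_mod_cast Nat.pos_of_ne_zero (NeZero.ne L)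
  rw [norm_sq_gridGramG, ← mul_sum]
  have hc : ‖((1 / (β * (L : ℝ) ^ 2) : ℝ) : ℂ)‖ ^ 2 = (1 / (β * (L : ℝ) ^ 2)) ^ 2 := by
    rw [Complex.norm_real, Real.norm_of_nonneg (by positivity)]
  rw [hc]
  calc (1 / (β * (L : ℝ) ^ 2)) ^ 2 * ∑ k : FreqMomentum L M'', ‖shellSymbolCT L h β μ K Λ (k, Y.1.2)‖
      ≤ (1 / (β * (L : ℝ) ^ 2)) ^ 2 * (β * (L : ℝ) ^ 2 * ((L : ℝ) ^ 2 * (2 * ((M'' : ℝ) - M) * (β / (Real.pi * (2 * M + 1)))))) :=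
        mul_le_mul_of_nonneg_left (sum_norm_shellSymbolCT_le hβ h μ K Λ _) (by positivity)
    _ = 2 * ((M'' : ℝ) - M) / (Real.pi * (2 * M + 1)) := by
        field_simp

omit [NeZero L] in
/-- Equal charge flags are equal charges. [cite: BenfattoGiulianiMastropietro2006, §2.8 (2.80)] -/
private theorem charge_eq_of_decide_eq {X Y : GridLeg P} (hq : decide (X.2 = 0) = decide (Y.2 = 0)) : X.2 = Y.2 := by
  rcases Fin.exists_fin_two.1 ⟨X.2, rfl⟩ with hX | hX <;> rcases Fin.exists_fin_two.1 ⟨Y.2, rfl⟩ with hY | hY <;> simp_all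

omit [NeZero L] in
/-- A false charge flag is charge `1`. [cite: BenfattoGiulianiMastropietro2006, §2.8 (2.80)] -/
private theorem charge_eq_one_of_decide {Y : GridLeg P} (hq : decide (Y.2 = 0) = false) : Y.2 = 1 := by
  rcases Fin.exists_fin_two.1 ⟨Y.2, rfl⟩ with hY | hY <;> simp_all

/-- **The charge hypothesis**: the pulled-back shell covariance vanishes between legs of equal charge.
[cite: BenfattoGiulianiMastropietro2006, §2.8 (2.80)] -/
theorem gridSub_hubbardCovShellCT_apply_of_charge_eq (h : M ≤ M'') (β μ : ℝ) (K : TrigPolyC4v) (Λ : ℝ)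
    (x : P → TorusSite 2 L) (τ : P → ℝ) {X Y : GridLeg P} (hXY : X.2 = Y.2) :
    ((gridSubMatrix L M'' β x τ).transpose * hubbardCovShellCT L h β μ 0 K Λ * gridSubMatrix L M'' β x τ) X Y = 0 := by
  rw [hubbardCovShellCT_zero_seed]
  exact gridSub_pullback_normalCovariance_apply_of_charge_eq β x τ _ hXY

variable [Fintype P]

/-- **The shell covariance, pulled back to ANY position–time grid, is replica-Gram-bounded with `κ_S = √(2(M″−M)/(π(2M+1)))`** —
bounded uniformly for a dyadic shell `M″ ≤ 2M` (`0 < β`, seed `0`). [cite: PedraSalmhofer2008, §5 Lemma 5.1] -/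
theorem isGramBoundedR_gridSub_hubbardCovShellCT {β : ℝ} (hβ : 0 < β) (h : M ≤ M'') (μ : ℝ) (K : TrigPolyC4v) (Λ : ℝ)
    (x : P → TorusSite 2 L) (τ : P → ℝ) :
    IsGramBoundedR ((gridSubMatrix L M'' β x τ).transpose * hubbardCovShellCT L h β μ 0 K Λ * gridSubMatrix L M'' β x τ)
      (Real.sqrt (2 * ((M'' : ℝ) - M) / (Real.pi * (2 * M + 1)))) := by
  set p := shellSymbolCT L h β μ K Λ with hp
  have hκ : 0 ≤ Real.sqrt (2 * ((M'' : ℝ) - M) / (Real.pi * (2 * M + 1))) := Real.sqrt_nonneg _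
  have hF : ∀ X : GridLeg P, ‖gridGramF L M'' β x τ p X‖ ≤ Real.sqrt (2 * ((M'' : ℝ) - M) / (Real.pi * (2 * M + 1))) := fun X =>
    Real.le_sqrt_of_sq_le (norm_sq_gridGramF_shell_le hβ h μ K Λ x τ X)
  have hG : ∀ Y : GridLeg P, ‖gridGramG L M'' β x τ p Y‖ ≤ Real.sqrt (2 * ((M'' : ℝ) - M) / (Real.pi * (2 * M + 1))) := fun Y =>
    Real.le_sqrt_of_sq_le (norm_sq_gridGramG_shell_le hβ h μ K Λ x τ Y)
  rw [hubbardCovShellCT_zero_seed]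
  exact isGramBoundedR_of_gram (fun X : GridLeg P => decide (X.2 = 0)) _
    (fun X Y hq => gridSub_pullback_normalCovariance_apply_of_charge_eq β x τ p (charge_eq_of_decide_eq hq))
    (gridGramF L M'' β x τ p) (gridGramG L M'' β x τ p) hκ (fun X _ => hF X) (fun Y _ => hG Y)
    (fun X Y hX hY => contr_gridSub_pullback_normalCovariance_eq_inner β x τ p (by simpa using hX) (charge_eq_one_of_decide hY))

variable [DecidableEq P]

/-- **The entry bound of the pulled-back shell covariance**: `‖(S(x,τ)ᵀ·S·S(x,τ)) X Y‖ ≤ κ_S² = 2(M″−M)/(π(2M+1))` (what the tadpole of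
the shell integration reads; antisymmetry turns the Gram pairing into the entry). [cite: PedraSalmhofer2008, §5 Lemma 5.1] -/
theorem norm_gridSub_hubbardCovShellCT_le {β : ℝ} (hβ : 0 < β) (h : M ≤ M'') (μ : ℝ) (K : TrigPolyC4v) (Λ : ℝ)
    (x : P → TorusSite 2 L) (τ : P → ℝ) (X Y : GridLeg P) :
    ‖((gridSubMatrix L M'' β x τ).transpose * hubbardCovShellCT L h β μ 0 K Λ * gridSubMatrix L M'' β x τ) X Y‖ ≤
      2 * ((M'' : ℝ) - M) / (Real.pi * (2 * M + 1)) := by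
  have hpair := (isGramBoundedR_gridSub_hubbardCovShellCT hβ h μ K Λ x τ).norm_pairing_le X Y
  set C' := (gridSubMatrix L M'' β x τ).transpose * hubbardCovShellCT L h β μ 0 K Λ * gridSubMatrix L M'' β x τ with hC'
  have hanti : C' Y X = -C' X Y := by
    have hT := congrFun (congrFun (gridSub_pullback_normalCovariance_transpose β x τ (shellSymbolCT L h β μ K Λ)) X) Y
    rw [← hubbardCovShellCT_zero_seed] at hT
    rwa [Matrix.transpose_apply, Matrix.neg_apply] at hT
  have hκ2 : Real.sqrt (2 * ((M'' : ℝ) - M) / (Real.pi * (2 * M + 1))) ^ 2 = 2 * ((M'' : ℝ) - M) / (Real.pi * (2 * M + 1)) := by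
    have hM : (M : ℝ) ≤ M'' := by exact_mod_cast h
    exact Real.sq_sqrt (by apply div_nonneg <;> nlinarith [Real.pi_pos])
  rw [hanti, show ((1 / 2 : ℚ) • (1 : ℂ)) * (-C' X Y - C' X Y) = -C' X Y by
    rw [show -C' X Y - C' X Y = -(2 * C' X Y) by ring, Rat.smul_one_eq_cast]; push_cast; ring, norm_neg, hκ2] at hpair
  exact hpair

end Gram

end Literature.MathematicalPhysics.QuantumLattice
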